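import Literature.Analysis.PDE.SobolevLinearTransport
import Literature.Analysis.PDE.TimeSobolevSup
import HarnessLib

/-!
# Finiteness of the Sobolev energies of compactly supported slab-smooth fields
# (topic `Analysis/PDE`)

Analytic layer of the programme to prove short-time existence for quasilinear strictly
parabolic systems on a closed manifold (hypothesis `hQL` of
`Literature.Geometry.Riemannian.ricciFlow_shortTime_existence_of_quasilinear`). The weighted
energy inequalities of that programme are closed by ABSORBING small multiples of the left-hand
side, which requires the absorbed quantities to be finite. This file proves the finiteness:
for a field `f : ℝ → E → F'` smooth on the closed slab `[0, T] × E` and vanishing off a fixed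
compact set `K`,

* `isSmoothSpaceTimeOn_iterDirDeriv_Icc` — every frame word derivative of `f` is slab-smooth;
* `exists_bound_iterDirDeriv_slab` — it is bounded on the slab, and vanishes off `K`;
* `exists_sobolevEnergy_slab_le` — `sup_{s ∈ [0,T]} E_i(f(s)) < ∞` for every order `i`
  (the energy as a sum over words, `sobolevEnergy_eq_sum_words`);
* `lintegral_weight_sobolevEnergy_slab_ne_top` — hence `∫₀ᵗ e^{-2λs} E_i(f(s)) ds < ∞`;
* `ENNReal.le_of_le_half_mul_add` — the absorption step `R ≤ ½R + D, R < ∞ ⇒ R ≤ 2D`.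

Everything is proved; no named fact and no `sorry` is introduced.

## References

* L. C. Evans, *Partial Differential Equations*, 2nd ed., AMS 2010, §7.1.2 (energy estimates:
  the absorption of lower-order terms). [Evans2010]
-/

noncomputable section

open MeasureTheory Set Function Filter Topology
open scoped ENNReal ContDiff

namespace Literature.Analysis.PDE

open Literature.Analysis.FunctionSpaces Literature.Analysis.FluidPDE

variable {E : Type*} [NormedAddCommGroup E] [InnerProductSpace ℝ E] [FiniteDimensional ℝ E]
  [MeasurableSpace E] [BorelSpace E]
variable {F' : Type*} [NormedAddCommGroup F'] [InnerProductSpace ℝ F']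

variable {T : ℝ} {f : ℝ → E → F'} {K : Set E}

omit [FiniteDimensional ℝ E] [MeasurableSpace E] [BorelSpace E] in
/-- Frame word derivatives of a slab-smooth field are slab-smooth. [folklore] -/
theorem isSmoothSpaceTimeOn_iterDirDeriv_Icc (hT : 0 < T) (hf : IsSmoothSpaceTimeOn (Icc 0 T) f) :
    ∀ β : List E, IsSmoothSpaceTimeOn (Icc 0 T) fun t ↦ iterDirDeriv β (f t)
  | [] => hf
  | v :: β => by
    have h := isSmoothSpaceTimeOn_fderiv_apply_Icc hT (isSmoothSpaceTimeOn_iterDirDeriv_Icc hT hf β) v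
    exact h

omit [FiniteDimensional ℝ E] [MeasurableSpace E] [BorelSpace E] in
/-- Word derivatives of a field vanishing off a closed set vanish off it. [folklore] -/
theorem iterDirDeriv_slice_eq_zero (hK : IsClosed K) (hfK : ∀ s, ∀ y ∉ K, f s y = 0)
    (β : List E) (s : ℝ) {y : E} (hy : y ∉ K) : iterDirDeriv β (f s) y = 0 := by
  have hts : tsupport (f s) ⊆ K := by
    refine closure_minimal (fun z hz ↦ ?_) hK
    by_contra h
    exact hz (hfK s z h)
  exact image_eq_zero_of_notMem_tsupport fun h ↦ hy (hts (tsupport_iterDirDeriv_subset β (f s) h))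

omit [FiniteDimensional ℝ E] [MeasurableSpace E] [BorelSpace E] in
/-- **Word derivatives of a compactly supported slab-smooth field are bounded on the slab.**
[folklore] -/
theorem exists_bound_iterDirDeriv_slab (hT : 0 < T) (hf : IsSmoothSpaceTimeOn (Icc 0 T) f)
    (hK : IsCompact K) (hfK : ∀ s, ∀ y ∉ K, f s y = 0) (β : List E) :
    ∃ C : ℝ, 0 ≤ C ∧ ∀ s ∈ Icc 0 T, ∀ y, ‖iterDirDeriv β (f s) y‖ ≤ C := by
  have hc : ContinuousOn (fun p : ℝ × E ↦ iterDirDeriv β (f p.1) p.2) (Icc 0 T ×ˢ univ) :=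
    (isSmoothSpaceTimeOn_iterDirDeriv_Icc hT hf β).continuousOn
  obtain ⟨C, hC⟩ := (isCompact_Icc.prod hK).exists_bound_of_continuousOn
    (hc.mono (prod_mono Subset.rfl (subset_univ _)))
  refine ⟨max C 0, le_max_right _ _, fun s hs y ↦ ?_⟩
  by_cases hy : y ∈ K
  · exact (hC (s, y) (mk_mem_prod hs hy)).trans (le_max_left _ _)
  · rw [iterDirDeriv_slice_eq_zero hK.isClosed hfK β s hy, norm_zero]
    exact le_max_right _ _

/-- The squared `L²` norm of a function bounded by `C` and vanishing off `K` is at most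
`C² · vol K`. [folklore] -/
theorem lintegral_enorm_sq_le_of_bound_of_support {G : Type*} [NormedAddCommGroup G] {g : E → G} {C : ℝ}
    (hC : ∀ y, ‖g y‖ ≤ C) (hgK : ∀ y ∉ K, g y = 0) :
    ∫⁻ y, ‖g y‖ₑ ^ 2 ≤ ENNReal.ofReal (C ^ 2) * volume K := by
  have hpt : ∀ y, ‖g y‖ₑ ^ 2 ≤ K.indicator (fun _ ↦ ENNReal.ofReal (C ^ 2)) y := by
    intro y
    by_cases hy : y ∈ K
    · rw [indicator_of_mem hy, ← ofReal_norm, ← ENNReal.ofReal_pow (norm_nonneg _)]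
      exact ENNReal.ofReal_le_ofReal (pow_le_pow_left₀ (norm_nonneg _) (hC y) 2)
    · rw [indicator_of_notMem hy, hgK y hy]
      simp
  calc ∫⁻ y, ‖g y‖ₑ ^ 2 ≤ ∫⁻ y, K.indicator (fun _ ↦ ENNReal.ofReal (C ^ 2)) y := lintegral_mono hpt
    _ ≤ ENNReal.ofReal (C ^ 2) * volume K := lintegral_indicator_const_le _ _

/-- **The energies of a compactly supported slab-smooth field are bounded on the slab.**
[cite: Evans2010, §7.1.2] -/
theorem exists_sobolevEnergy_slab_le (hT : 0 < T) (hf : IsSmoothSpaceTimeOn (Icc 0 T) f)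
    (hK : IsCompact K) (hfK : ∀ s, ∀ y ∉ K, f s y = 0) (i : ℕ) :
    ∃ C : ℝ≥0∞, C ≠ ⊤ ∧ ∀ s ∈ Icc 0 T, sobolevEnergy i (f s) ≤ C := by
  classical
  set b := stdOrthonormalBasis ℝ E
  -- a bound for every word
  have hw : ∀ (j : ℕ) (β : Fin j → Fin (Module.finrank ℝ E)), ∃ C : ℝ, 0 ≤ C ∧
      ∀ s ∈ Icc 0 T, ∀ y, ‖iterDirDeriv (List.ofFn fun l ↦ b (β l)) (f s) y‖ ≤ C :=
    fun j β ↦ exists_bound_iterDirDeriv_slab hT hf hK hfK _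
  choose C hC0 hC using hw
  have hvol : volume K ≠ ⊤ := hK.measure_lt_top.ne
  refine ⟨∑ j ∈ Finset.range (i + 1), ∑ β : Fin j → Fin (Module.finrank ℝ E),
    ENNReal.ofReal (C j β ^ 2) * volume K, ?_, fun s hs ↦ ?_⟩
  · exact ENNReal.sum_ne_top.2 fun j _ ↦ ENNReal.sum_ne_top.2 fun β _ ↦
      ENNReal.mul_ne_top ENNReal.ofReal_ne_top hvol
  · rw [sobolevEnergy_eq_sum_words]
    refine Finset.sum_le_sum fun j _ ↦ Finset.sum_le_sum fun β _ ↦ ?_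
    exact lintegral_enorm_sq_le_of_bound_of_support (hC j β s hs)
      fun y hy ↦ iterDirDeriv_slice_eq_zero hK.isClosed hfK _ s hy

/-- **The weighted time integrals of the energies are finite**: for `0 ≤ λ` and `t ≤ T`,
`∫_{(0,t)} e^{-2λs} E_i(f(s)) ds < ∞`. [cite: Evans2010, §7.1.2] -/
theorem lintegral_weight_sobolevEnergy_slab_ne_top (hT : 0 < T) (hf : IsSmoothSpaceTimeOn (Icc 0 T) f)
    (hK : IsCompact K) (hfK : ∀ s, ∀ y ∉ K, f s y = 0) (i : ℕ) {lam : ℝ} (hlam : 0 ≤ lam) {t : ℝ}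
    (ht : t ≤ T) :
    ∫⁻ s in Ioo 0 t, ENNReal.ofReal (Real.exp (-2 * lam * s)) * sobolevEnergy i (f s) ≠ ⊤ := by
  obtain ⟨C, hCtop, hC⟩ := exists_sobolevEnergy_slab_le hT hf hK hfK i
  refine ne_top_of_le_ne_top (ENNReal.mul_ne_top hCtop
    (measure_Ioo_lt_top (μ := (volume : Measure ℝ)) (a := (0 : ℝ)) (b := t)).ne) ?_
  calc ∫⁻ s in Ioo 0 t, ENNReal.ofReal (Real.exp (-2 * lam * s)) * sobolevEnergy i (f s)
      ≤ ∫⁻ s in Ioo 0 t, C := by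
        refine setLIntegral_mono' measurableSet_Ioo fun s hs ↦ ?_
        have hw : ENNReal.ofReal (Real.exp (-2 * lam * s)) ≤ 1 := by
          rw [← ENNReal.ofReal_one]
          refine ENNReal.ofReal_le_ofReal (Real.exp_le_one_iff.2 ?_)
          nlinarith [hs.1.le]
        calc ENNReal.ofReal (Real.exp (-2 * lam * s)) * sobolevEnergy i (f s)
            ≤ 1 * C := mul_le_mul' hw (hC s ⟨hs.1.le, hs.2.le.trans ht⟩)
          _ = C := one_mul C
    _ = C * volume (Ioo (0 : ℝ) t) := setLIntegral_const _ _

/-- **The absorption step**: if `R ≤ ½ R + D` with `R < ∞` then `R ≤ 2 D`. [folklore] -/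
theorem ENNReal.le_of_le_half_mul_add {R D : ℝ≥0∞} (hR : R ≠ ⊤) (h : R ≤ 2⁻¹ * R + D) : R ≤ 2 * D := by
  have h1 : R - 2⁻¹ * R ≤ D := tsub_le_iff_right.2 (by rw [add_comm]; exact h)
  have h2 : R - 2⁻¹ * R = 2⁻¹ * R := by
    rw [mul_comm, ← div_eq_mul_inv, ENNReal.sub_half hR, div_eq_mul_inv, mul_comm]
  rw [h2] at h1
  calc R = 2 * (2⁻¹ * R) := by rw [← mul_assoc, ENNReal.mul_inv_cancel two_ne_zero (by simp), one_mul]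
    _ ≤ 2 * D := mul_le_mul' le_rfl h1

/-- The absorption step with a general factor `c ≤ ½`. [folklore] -/
theorem ENNReal.le_of_le_mul_add {R D c : ℝ≥0∞} (hR : R ≠ ⊤) (hc : c ≤ 2⁻¹) (h : R ≤ c * R + D) :
    R ≤ 2 * D :=
  ENNReal.le_of_le_half_mul_add hR (h.trans (add_le_add (mul_le_mul' hc le_rfl) le_rfl))

end Literature.Analysis.PDE

end
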